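import Mathlib
import Summits.NavierStokesRegularity.NavierStokesRegularity.Theorems.FilamentSkeletonRssDefectColumnGateAzimuthalBlockPrelim

/-!
# Route `FilamentSkeletonRss` · crux `TransverseReduction1AG` (stmt-NavierStokesRegularity-27853; A1L twin stmt-23297) · line
# `defect_column_gate_1AG/1AL` — the ROTATION LEVER of the azimuthal blocks of the localised sectional waist gate `WaistColumnGateLoc1A`
# (stub S2a-loc): the exact angular-momentum flux identity, and the Biot–Savart sup bound for the stream coefficient

Helper file (`--supports stmt-NavierStokesRegularity-27853 --as helper`; seat ns-filament-s2aloc-p1 g2, MINT req187 no-hit branch; bricks 2 and 4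
of the seat's note ARCHITECTURE-B2B3-s2aloc-g2.md, evidence #52 on 27853 / #13 on 23297).  Companions: `…AzimuthalBlock.lean` (p671383,
the V-blind modulus bound for `m² ≥ 9`), `…AzimuthalBlockExterior.lean` (exterior zone, every `m`), `…AzimuthalBlockPrelim.lean` (p670849).

THE BLOCK (dictionary as in `…AzimuthalBlock.lean`): in `u = r²`, `w = a + ib` the order-`m` vorticity coefficient of an axially constant
horizontal perturbation of the symmetric column, `Φ_a = 4u a′ + γu a`, `Φ_b = 4u b′ + γu b`,
`Φ_a′ = (m²/u) a − V b − f₁`, `Φ_b′ = (m²/u) b + V a − f₂` with an arbitrary real rotation potential `V` (frame rotation + `Rc·Ω`).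

§1 THE ROTATION LEVER (what the modulus bound of `…AzimuthalBlock.lean` cannot see).  With the phase flux `J = a b′ − b a′ = Im(w̄ w′)`:
`a Φ_b − b Φ_a = 4uJ` (`rotationFlux_eq`), and the mode system gives the EXACT identity
`(a Φ_b − b Φ_a)′ = V·(a² + b²) − (a f₂ − b f₁) − γuJ` (`rotationFlux_hasDerivAt`), i.e. with the Gaussian weight `E = e^{γu/4}`:
`(E·(a Φ_b − b Φ_a))′ = E·(V·(a²+b²) − (a f₂ − b f₁))` (`rotationFlux_gauss_hasDerivAt`) — the potential is now ALONE on the right with the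
modulus: integrated over the support, `∫ E V (a²+b²) = ∫ E (a f₂ − b f₁)` (`rotationFlux_gauss_integral`, on any `[x, y] ⊂ (0,∞)` as an FTC
statement).  With a general weight `ρ` the same computation leaves `uJ(4ρ′ − γρ)` (`rotationFlux_weight_hasDerivAt`), which vanishes exactly for
`ρ = E`: this is the 1-D form of the Gallay–Wayne skewness, and the source of the `1/Rc` gain in the Gaussian core (imaginary part of the
`L²(dξ/G)` pairing; the Biot–Savart part of `f` is then absorbed by the ground-state inequality of the note, §2(c)).

§2 THE BIOT–SAVART SUP BOUND (`streamCoeff_le`, `abs_streamCoeff_le`).  If `φ` (a real component of the stream coefficient) satisfies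
`4u φ″ + 4φ′ = (m²/u) φ − w` on `(0,∞)` (i.e. `w = −Δ_m φ` in `u = r²`), `φ(0) = 0`, `φ = 0` on `[U,∞)`, and `u|w| ≤ N` on `(0,∞)`, then
`|φ| ≤ N/m²` on `[0,∞)` for every `m ≠ 0` — by the first-order maximum principle `maxPrinciple_of_wronskian` with flux `u φ′` (no closed-form
Biot–Savart kernel needed).  This is what makes the Biot–Savart source `m Rc (γ/2) e^{−γu/4} φ` of the exterior zone absorbable.
HONEST FRAMING: elementary identities/estimates about ONE family of blocks of ONE linear MODEL operator of a hypothetical blow-up route (MODEL rung,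
negative side); `WaistColumnGateLoc1A`, `TransverseReduction1AG/1AL` are neither proved nor refuted here; nothing in this file bears on
Navier–Stokes regularity.
-/

set_option linter.dupNamespace false

noncomputable section

namespace Summit.NavierStokesRegularity.NavierStokesRegularity.Theorems.DefectColumnGate

open scoped Topology
open Set Filter MeasureTheory intervalIntegral

/-! ## 1. The rotation lever: angular-momentum flux identities -/

/-- `a Φ_b − b Φ_a = 4u·(a b′ − b a′)`: the cross flux is `4u` times the phase flux `J = Im(w̄ w′)` (pure algebra). -/
theorem rotationFlux_eq (γ u : ℝ) (a a₁ b b₁ : ℝ) :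
    a * (4 * u * b₁ + γ * u * b) - b * (4 * u * a₁ + γ * u * a) = 4 * u * (a * b₁ - b * a₁) := by
  ring

/-- **The rotation lever, pointwise.**  Under the mode system at a point `u`:
`(a Φ_b − b Φ_a)′ = V(a² + b²) − (a f₂ − b f₁) − γu(a b′ − b a′)`. -/
theorem rotationFlux_hasDerivAt {γ m u : ℝ} {a a₁ b b₁ f₁ f₂ V : ℝ → ℝ}
    (hdera : HasDerivAt a (a₁ u) u) (hderb : HasDerivAt b (b₁ u) u)
    (hΦa : HasDerivAt (fun s => 4 * s * a₁ s + γ * s * a s) (m ^ 2 / u * a u - V u * b u - f₁ u) u)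
    (hΦb : HasDerivAt (fun s => 4 * s * b₁ s + γ * s * b s) (m ^ 2 / u * b u + V u * a u - f₂ u) u) :
    HasDerivAt (fun s => a s * (4 * s * b₁ s + γ * s * b s) - b s * (4 * s * a₁ s + γ * s * a s))
      (V u * (a u ^ 2 + b u ^ 2) - (a u * f₂ u - b u * f₁ u) - γ * u * (a u * b₁ u - b u * a₁ u)) u := by
  have h := (hdera.mul hΦb).sub (hderb.mul hΦa)
  exact h.congr_deriv (by ring)

/-- **The rotation lever with a general weight `ρ`.**  `(ρ·(a Φ_b − b Φ_a))′ = ρ(V(a²+b²) − (a f₂ − b f₁)) + u(a b′ − b a′)(4ρ′ − γρ)`: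
the weight error `4ρ′ − γρ` vanishes exactly for the Gaussian weight `ρ = e^{γu/4}`. -/
theorem rotationFlux_weight_hasDerivAt {γ m u : ℝ} {a a₁ b b₁ f₁ f₂ V ρ : ℝ → ℝ} {ρ' : ℝ}
    (hρ : HasDerivAt ρ ρ' u)
    (hdera : HasDerivAt a (a₁ u) u) (hderb : HasDerivAt b (b₁ u) u)
    (hΦa : HasDerivAt (fun s => 4 * s * a₁ s + γ * s * a s) (m ^ 2 / u * a u - V u * b u - f₁ u) u)
    (hΦb : HasDerivAt (fun s => 4 * s * b₁ s + γ * s * b s) (m ^ 2 / u * b u + V u * a u - f₂ u) u) :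
    HasDerivAt (fun s => ρ s * (a s * (4 * s * b₁ s + γ * s * b s) - b s * (4 * s * a₁ s + γ * s * a s)))
      (ρ u * (V u * (a u ^ 2 + b u ^ 2) - (a u * f₂ u - b u * f₁ u))
        + u * (a u * b₁ u - b u * a₁ u) * (4 * ρ' - γ * ρ u)) u := by
  have h := hρ.mul (rotationFlux_hasDerivAt hdera hderb hΦa hΦb)
  exact h.congr_deriv (by ring)

/-- **The rotation lever with the Gaussian weight.**  `(e^{γu/4}·(a Φ_b − b Φ_a))′ = e^{γu/4}·(V(a²+b²) − (a f₂ − b f₁))`. -/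
theorem rotationFlux_gauss_hasDerivAt {γ m u : ℝ} {a a₁ b b₁ f₁ f₂ V : ℝ → ℝ}
    (hdera : HasDerivAt a (a₁ u) u) (hderb : HasDerivAt b (b₁ u) u)
    (hΦa : HasDerivAt (fun s => 4 * s * a₁ s + γ * s * a s) (m ^ 2 / u * a u - V u * b u - f₁ u) u)
    (hΦb : HasDerivAt (fun s => 4 * s * b₁ s + γ * s * b s) (m ^ 2 / u * b u + V u * a u - f₂ u) u) :
    HasDerivAt (fun s => Real.exp (γ * s / 4) * (a s * (4 * s * b₁ s + γ * s * b s) - b s * (4 * s * a₁ s + γ * s * a s)))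
      (Real.exp (γ * u / 4) * (V u * (a u ^ 2 + b u ^ 2) - (a u * f₂ u - b u * f₁ u))) u := by
  have hE : HasDerivAt (fun s : ℝ => Real.exp (γ * s / 4)) (Real.exp (γ * u / 4) * (γ / 4)) u := by
    have h1 : HasDerivAt (fun s : ℝ => γ * s / 4) (γ / 4) u := by
      simpa using ((hasDerivAt_id' u).const_mul γ).div_const 4
    exact h1.exp
  have h := rotationFlux_weight_hasDerivAt (ρ := fun s => Real.exp (γ * s / 4)) hE hdera hderb hΦa hΦb
  exact h.congr_deriv (by ring)

/-- **The rotation lever, integrated (FTC form).**  On `[x, y] ⊂ (0, ∞)` where the mode system holds and the right-hand side is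
interval-integrable: `∫_x^y e^{γu/4}(V(a²+b²) − (a f₂ − b f₁)) du = [e^{γu/4}(a Φ_b − b Φ_a)]_x^y`.  With `x, y` outside the support of the
mode (both brackets zero) this is `∫ E V (a²+b²) = ∫ E (a f₂ − b f₁)`: the potential tests the Gaussian-weighted modulus EXACTLY. -/
theorem rotationFlux_gauss_integral {γ m x y : ℝ} {a a₁ b b₁ f₁ f₂ V : ℝ → ℝ} (hx : 0 < x) (hxy : x ≤ y)
    (hdera : ∀ u, 0 < u → HasDerivAt a (a₁ u) u) (hderb : ∀ u, 0 < u → HasDerivAt b (b₁ u) u)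
    (hΦa : ∀ u, 0 < u →
      HasDerivAt (fun s => 4 * s * a₁ s + γ * s * a s) (m ^ 2 / u * a u - V u * b u - f₁ u) u)
    (hΦb : ∀ u, 0 < u →
      HasDerivAt (fun s => 4 * s * b₁ s + γ * s * b s) (m ^ 2 / u * b u + V u * a u - f₂ u) u)
    (hint : IntervalIntegrable (fun u => Real.exp (γ * u / 4) * (V u * (a u ^ 2 + b u ^ 2) - (a u * f₂ u - b u * f₁ u))) volume x y) :
    ∫ u in x..y, Real.exp (γ * u / 4) * (V u * (a u ^ 2 + b u ^ 2) - (a u * f₂ u - b u * f₁ u))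
      = Real.exp (γ * y / 4) * (a y * (4 * y * b₁ y + γ * y * b y) - b y * (4 * y * a₁ y + γ * y * a y))
        - Real.exp (γ * x / 4) * (a x * (4 * x * b₁ x + γ * x * b x) - b x * (4 * x * a₁ x + γ * x * a x)) := by
  apply integral_eq_sub_of_hasDerivAt
  · intro u hu
    rw [uIcc_of_le hxy] at hu
    have hu0 : 0 < u := lt_of_lt_of_le hx hu.1
    exact rotationFlux_gauss_hasDerivAt (hdera u hu0) (hderb u hu0) (hΦa u hu0) (hΦb u hu0)
  · exact hint

/-! ## 2. The Biot–Savart sup bound for the stream coefficient -/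

/-- **Stream coefficient sup bound (one-sided).**  `φ, φ₁` with `φ′ = φ₁` on `(0,∞)`, `φ` continuous on `[0,∞)`, `φ(0) = 0`, `φ = 0` on
`[U,∞)`, and the `m`-Poisson equation in `u = r²` in flux form `(u φ₁)′ = ((m²/u)φ − w)/4` on `(0,∞)` with `u|w| ≤ N`, `m ≠ 0`: then
`φ ≤ N/m²` on `[0,∞)`. -/
theorem streamCoeff_le {m U N : ℝ} {φ φ₁ w : ℝ → ℝ} (hm : m ≠ 0) (hU : 0 < U)
    (hφ : ContinuousOn φ (Ici 0)) (hφ0 : φ 0 = 0)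
    (hder : ∀ u, 0 < u → HasDerivAt φ (φ₁ u) u)
    (hflux : ∀ u, 0 < u → HasDerivAt (fun s => s * φ₁ s) ((m ^ 2 / u * φ u - w u) / 4) u)
    (hw : ∀ u, 0 < u → u * |w u| ≤ N)
    (hsupp : ∀ u, U ≤ u → φ u = 0) :
    ∀ u, 0 ≤ u → φ u ≤ N / m ^ 2 := by
  have hm2 : 0 < m ^ 2 := by positivity
  have hN : 0 ≤ N := le_trans (by positivity) (hw 1 one_pos)
  have hK : 0 ≤ N / m ^ 2 := by positivity
  have hMP : ∀ u ∈ Icc 0 U, φ u ≤ N / m ^ 2 := by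
    refine maxPrinciple_of_wronskian (v := φ) (v₁ := φ₁) (Wr := fun s => s * φ₁ s) (P := fun s => s) hU.le
      (hφ.mono (fun t ht => ht.1)) (fun u hu => hder u hu.1) (fun u _ => rfl) (fun u hu => hu.1) ?_
      (by rw [hφ0]; exact hK) (by rw [hsupp U le_rfl]; exact hK)
    intro u hu hφK hφ₁0
    refine ⟨(m ^ 2 / u * φ u - w u) / 4, ?_, hflux u hu.1⟩
    have hu0 : 0 < u := hu.1
    have h1 : w u ≤ N / u := by
      rw [le_div_iff₀ hu0]
      have := hw u hu0
      have h2 : w u * u ≤ |w u| * u := mul_le_mul_of_nonneg_right (le_abs_self _) hu0.le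
      linarith [mul_comm u (|w u|)]
    have h3 : N / u < m ^ 2 / u * φ u := by
      rw [div_lt_iff₀ hu0]
      have h4 : N < m ^ 2 * φ u := by
        have := (div_lt_iff₀' hm2).mp hφK
        linarith
      have : m ^ 2 / u * φ u * u = m ^ 2 * φ u := by field_simp
      linarith
    linarith
  intro u hu
  rcases le_or_gt u U with h | h
  · exact hMP u ⟨hu, h⟩
  · rw [hsupp u h.le]; exact hK

/-- **Stream coefficient sup bound.**  Under the hypotheses of `streamCoeff_le`: `|φ| ≤ N/m²` on `[0,∞)` (apply the one-sided bound to
`φ` and to `−φ`).  In the dictionary: `sup|φ_m| ≤ sup(u|ω_m|)/m² ≤ sup((1+u)²|ω_m|)/m²` for every `m ≠ 0`. -/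
theorem abs_streamCoeff_le {m U N : ℝ} {φ φ₁ w : ℝ → ℝ} (hm : m ≠ 0) (hU : 0 < U)
    (hφ : ContinuousOn φ (Ici 0)) (hφ0 : φ 0 = 0)
    (hder : ∀ u, 0 < u → HasDerivAt φ (φ₁ u) u)
    (hflux : ∀ u, 0 < u → HasDerivAt (fun s => s * φ₁ s) ((m ^ 2 / u * φ u - w u) / 4) u)
    (hw : ∀ u, 0 < u → u * |w u| ≤ N)
    (hsupp : ∀ u, U ≤ u → φ u = 0) :
    ∀ u, 0 ≤ u → |φ u| ≤ N / m ^ 2 := by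
  have hpos := streamCoeff_le hm hU hφ hφ0 hder hflux hw hsupp
  have hneg : ∀ u, 0 ≤ u → -φ u ≤ N / m ^ 2 := by
    refine streamCoeff_le (φ := fun s => -φ s) (φ₁ := fun s => -φ₁ s) (w := fun s => -w s) hm hU hφ.neg
      (by simp [hφ0]) (fun u hu => (hder u hu).neg) ?_ ?_ (fun u hu => by simp [hsupp u hu])
    · intro u hu
      -- the flux of `−φ` from the flux of `φ`
      have h2 : HasDerivAt (fun s => s * -φ₁ s) (-((m ^ 2 / u * φ u - w u) / 4)) u := by
        have e : (fun s : ℝ => s * -φ₁ s) = fun s => -(s * φ₁ s) := by funext s; ring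
        rw [e]
        exact (hflux u hu).neg
      exact h2.congr_deriv (by ring)
    · intro u hu; simpa [abs_neg] using hw u hu
  intro u hu
  exact abs_le.mpr ⟨by linarith [hneg u hu], hpos u hu⟩

/-! ## 3. APPENDED (same seat, same gen): the MODULUS flux with a general weight — the real-part companion of §1

With `Y := (a Φ_a + b Φ_b − γu·(a²+b²))/2 = 2u(a a′ + b b′) = u·s′` (`s = a² + b²`), the mode system gives
`Y′ = ½[4u(a′² + b′²) + (m²/u − γ)s − (a f₁ + b f₂)] − (γ/4)Y` — again with the potential `V` GONE and without second derivatives of `a, b`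
(only the fluxes are differentiated).  Hence for a weight `σ`: `(σY)′ = (σ/2)[4u(a′²+b′²) + (m²/u − γ)s − (a f₁ + b f₂)] + Y(σ′ − γσ/4)`
(`modulusFlux_weight_hasDerivAt`); the weight error vanishes exactly for `σ = e^{γu/4}` (`modulusFlux_gauss_hasDerivAt`), and integrating over
the support gives the Gaussian DISSIPATION IDENTITY `∫ e^{γu/4}[4u(a′²+b′²) + (m²/u)(a²+b²)] = ∫ e^{γu/4}[γ(a²+b²) + (a f₁ + b f₂)]`
(`modulusFlux_gauss_integral`) — the 1-D form of `Re⟨L_OU w, w⟩_X = ‖∇(w/G)‖²_{L²(G)}`; it is what controls `u|w′|²` (hence the weight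
errors `u·Im(w̄w′)·(4ρ′ − γρ)` of §1 beyond the Gaussian core) in the seat's two-zone scheme. -/

/-- **The modulus flux with a general weight `σ`.**  Under the mode system at `u` (any `V`, any `f`):
`(σ·(aΦ_a + bΦ_b − γu(a²+b²))/2)′ = (σ/2)[4u(a₁² + b₁²) + (m²/u − γ)(a²+b²) − (a f₁ + b f₂)] + 2u(a a₁ + b b₁)·(σ′ − γσ/4)`. -/
theorem modulusFlux_weight_hasDerivAt {γ m u : ℝ} {a a₁ b b₁ f₁ f₂ V σ : ℝ → ℝ} {σ' : ℝ}
    (hσ : HasDerivAt σ σ' u)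
    (hdera : HasDerivAt a (a₁ u) u) (hderb : HasDerivAt b (b₁ u) u)
    (hΦa : HasDerivAt (fun s => 4 * s * a₁ s + γ * s * a s) (m ^ 2 / u * a u - V u * b u - f₁ u) u)
    (hΦb : HasDerivAt (fun s => 4 * s * b₁ s + γ * s * b s) (m ^ 2 / u * b u + V u * a u - f₂ u) u) :
    HasDerivAt (fun s => σ s * ((a s * (4 * s * a₁ s + γ * s * a s) + b s * (4 * s * b₁ s + γ * s * b s)
        - γ * s * (a s ^ 2 + b s ^ 2)) / 2))
      (σ u * (4 * u * (a₁ u ^ 2 + b₁ u ^ 2) + (m ^ 2 / u - γ) * (a u ^ 2 + b u ^ 2) - (a u * f₁ u + b u * f₂ u)) / 2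
        + 2 * u * (a u * a₁ u + b u * b₁ u) * (σ' - γ * σ u / 4)) u := by
  have hS : HasDerivAt (fun s => a s ^ 2 + b s ^ 2) (2 * a u * a₁ u + 2 * b u * b₁ u) u :=
    ((hdera.fun_pow 2).congr_deriv (by norm_num)).add ((hderb.fun_pow 2).congr_deriv (by norm_num))
  have hγt : HasDerivAt (fun s : ℝ => γ * s) γ u := by simpa using (hasDerivAt_id' u).const_mul γ
  have hY : HasDerivAt (fun s => (a s * (4 * s * a₁ s + γ * s * a s) + b s * (4 * s * b₁ s + γ * s * b s)
      - γ * s * (a s ^ 2 + b s ^ 2)) / 2)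
      ((a₁ u * (4 * u * a₁ u + γ * u * a u) + a u * (m ^ 2 / u * a u - V u * b u - f₁ u)
        + (b₁ u * (4 * u * b₁ u + γ * u * b u) + b u * (m ^ 2 / u * b u + V u * a u - f₂ u))
        - (γ * (a u ^ 2 + b u ^ 2) + γ * u * (2 * a u * a₁ u + 2 * b u * b₁ u))) / 2) u :=
    (((hdera.mul hΦa).add (hderb.mul hΦb)).sub (hγt.mul hS)).div_const 2
  have h := hσ.mul hY
  exact h.congr_deriv (by ring)

/-- **The modulus flux with the Gaussian weight**: the weight error vanishes,
`(e^{γu/4}·(aΦ_a + bΦ_b − γu(a²+b²))/2)′ = (e^{γu/4}/2)[4u(a₁² + b₁²) + (m²/u − γ)(a²+b²) − (a f₁ + b f₂)]`. -/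
theorem modulusFlux_gauss_hasDerivAt {γ m u : ℝ} {a a₁ b b₁ f₁ f₂ V : ℝ → ℝ}
    (hdera : HasDerivAt a (a₁ u) u) (hderb : HasDerivAt b (b₁ u) u)
    (hΦa : HasDerivAt (fun s => 4 * s * a₁ s + γ * s * a s) (m ^ 2 / u * a u - V u * b u - f₁ u) u)
    (hΦb : HasDerivAt (fun s => 4 * s * b₁ s + γ * s * b s) (m ^ 2 / u * b u + V u * a u - f₂ u) u) :
    HasDerivAt (fun s => Real.exp (γ * s / 4) * ((a s * (4 * s * a₁ s + γ * s * a s) + b s * (4 * s * b₁ s + γ * s * b s)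
        - γ * s * (a s ^ 2 + b s ^ 2)) / 2))
      (Real.exp (γ * u / 4) * (4 * u * (a₁ u ^ 2 + b₁ u ^ 2) + (m ^ 2 / u - γ) * (a u ^ 2 + b u ^ 2)
        - (a u * f₁ u + b u * f₂ u)) / 2) u := by
  have hE : HasDerivAt (fun s : ℝ => Real.exp (γ * s / 4)) (Real.exp (γ * u / 4) * (γ / 4)) u := by
    have h1 : HasDerivAt (fun s : ℝ => γ * s / 4) (γ / 4) u := by
      simpa using ((hasDerivAt_id' u).const_mul γ).div_const 4
    exact h1.exp
  have h := modulusFlux_weight_hasDerivAt (σ := fun s => Real.exp (γ * s / 4)) hE hdera hderb hΦa hΦb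
  exact h.congr_deriv (by ring)

/-- **The Gaussian dissipation identity on a sub-interval (FTC form, boundary fluxes kept).**  On `[x, y]` (`x ≤ y`) with `a, b, Φ_a, Φ_b`
continuous on `[x,y]`, the mode system on `(x,y)` and the integrand interval-integrable:
`∫_x^y (e^{γu/4}/2)[4u(a₁²+b₁²) + (m²/u − γ)(a²+b²) − (a f₁ + b f₂)] = [e^{γu/4}·(aΦ_a + bΦ_b − γu(a²+b²))/2]_x^y`.  (Truncated Gaussian
identities with their boundary fluxes are what the seat's two-zone scheme averages over a layer of truncation points.) -/
theorem modulusFlux_gauss_integral_sub {γ m x y : ℝ} {a a₁ b b₁ f₁ f₂ V : ℝ → ℝ} (hxy : x ≤ y)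
    (ha : ContinuousOn a (Icc x y)) (hb : ContinuousOn b (Icc x y))
    (hΦac : ContinuousOn (fun s => 4 * s * a₁ s + γ * s * a s) (Icc x y))
    (hΦbc : ContinuousOn (fun s => 4 * s * b₁ s + γ * s * b s) (Icc x y))
    (hdera : ∀ u ∈ Ioo x y, HasDerivAt a (a₁ u) u) (hderb : ∀ u ∈ Ioo x y, HasDerivAt b (b₁ u) u)
    (hΦa : ∀ u ∈ Ioo x y,
      HasDerivAt (fun s => 4 * s * a₁ s + γ * s * a s) (m ^ 2 / u * a u - V u * b u - f₁ u) u)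
    (hΦb : ∀ u ∈ Ioo x y,
      HasDerivAt (fun s => 4 * s * b₁ s + γ * s * b s) (m ^ 2 / u * b u + V u * a u - f₂ u) u)
    (hI : IntervalIntegrable (fun u => Real.exp (γ * u / 4) * (4 * u * (a₁ u ^ 2 + b₁ u ^ 2)
      + (m ^ 2 / u - γ) * (a u ^ 2 + b u ^ 2) - (a u * f₁ u + b u * f₂ u)) / 2) volume x y) :
    ∫ u in x..y, Real.exp (γ * u / 4) * (4 * u * (a₁ u ^ 2 + b₁ u ^ 2)
        + (m ^ 2 / u - γ) * (a u ^ 2 + b u ^ 2) - (a u * f₁ u + b u * f₂ u)) / 2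
      = Real.exp (γ * y / 4) * ((a y * (4 * y * a₁ y + γ * y * a y) + b y * (4 * y * b₁ y + γ * y * b y)
          - γ * y * (a y ^ 2 + b y ^ 2)) / 2)
        - Real.exp (γ * x / 4) * ((a x * (4 * x * a₁ x + γ * x * a x) + b x * (4 * x * b₁ x + γ * x * b x)
          - γ * x * (a x ^ 2 + b x ^ 2)) / 2) := by
  have hcont : ContinuousOn (fun s => Real.exp (γ * s / 4) * ((a s * (4 * s * a₁ s + γ * s * a s)
      + b s * (4 * s * b₁ s + γ * s * b s) - γ * s * (a s ^ 2 + b s ^ 2)) / 2)) (Icc x y) := by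
    have hE : ContinuousOn (fun s : ℝ => Real.exp (γ * s / 4)) (Icc x y) :=
      (Real.continuous_exp.comp (by continuity)).continuousOn
    have hγs : ContinuousOn (fun s : ℝ => γ * s) (Icc x y) := (continuous_const.mul continuous_id).continuousOn
    exact hE.mul ((((ha.mul hΦac).add (hb.mul hΦbc)).sub (hγs.mul ((ha.pow 2).add (hb.pow 2)))).div_const 2)
  exact integral_eq_sub_of_hasDerivAt_of_le hxy hcont
    (fun u hu => modulusFlux_gauss_hasDerivAt (hdera u hu) (hderb u hu) (hΦa u hu) (hΦb u hu)) hI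

/-- **The Gaussian dissipation identity on the support.**  `a, b, Φ_a, Φ_b` continuous on `[0,U]`, the mode system on `(0,U)`,
`a(U) = b(U) = 0`, integrands interval-integrable:
`∫₀^U e^{γu/4}[4u(a₁² + b₁²) + (m²/u)(a²+b²)] = ∫₀^U e^{γu/4}[γ(a²+b²) + (a f₁ + b f₂)]` — the 1-D form of
`Re⟨L_OU w, w⟩_X = ‖∇(w/G)‖²_{L²(G dξ)}`: Gaussian-weighted DISSIPATION is paid by `γ`·mass and the forcing only (the potential `V` is absent). -/
theorem modulusFlux_gauss_integral {γ m U : ℝ} {a a₁ b b₁ f₁ f₂ V : ℝ → ℝ} (hU : 0 ≤ U)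
    (ha : ContinuousOn a (Icc 0 U)) (hb : ContinuousOn b (Icc 0 U))
    (hΦac : ContinuousOn (fun s => 4 * s * a₁ s + γ * s * a s) (Icc 0 U))
    (hΦbc : ContinuousOn (fun s => 4 * s * b₁ s + γ * s * b s) (Icc 0 U))
    (hdera : ∀ u ∈ Ioo 0 U, HasDerivAt a (a₁ u) u) (hderb : ∀ u ∈ Ioo 0 U, HasDerivAt b (b₁ u) u)
    (hΦa : ∀ u ∈ Ioo 0 U,
      HasDerivAt (fun s => 4 * s * a₁ s + γ * s * a s) (m ^ 2 / u * a u - V u * b u - f₁ u) u)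
    (hΦb : ∀ u ∈ Ioo 0 U,
      HasDerivAt (fun s => 4 * s * b₁ s + γ * s * b s) (m ^ 2 / u * b u + V u * a u - f₂ u) u)
    (haU : a U = 0) (hbU : b U = 0)
    (hID : IntervalIntegrable (fun u => Real.exp (γ * u / 4)
      * (4 * u * (a₁ u ^ 2 + b₁ u ^ 2) + m ^ 2 / u * (a u ^ 2 + b u ^ 2))) volume 0 U)
    (hIR : IntervalIntegrable (fun u => Real.exp (γ * u / 4)
      * (γ * (a u ^ 2 + b u ^ 2) + (a u * f₁ u + b u * f₂ u))) volume 0 U) :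
    ∫ u in (0:ℝ)..U, Real.exp (γ * u / 4) * (4 * u * (a₁ u ^ 2 + b₁ u ^ 2) + m ^ 2 / u * (a u ^ 2 + b u ^ 2))
      = ∫ u in (0:ℝ)..U, Real.exp (γ * u / 4) * (γ * (a u ^ 2 + b u ^ 2) + (a u * f₁ u + b u * f₂ u)) := by
  have hint : IntervalIntegrable (fun u => Real.exp (γ * u / 4) * (4 * u * (a₁ u ^ 2 + b₁ u ^ 2)
      + (m ^ 2 / u - γ) * (a u ^ 2 + b u ^ 2) - (a u * f₁ u + b u * f₂ u)) / 2) volume 0 U := by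
    have e : (fun u => Real.exp (γ * u / 4) * (4 * u * (a₁ u ^ 2 + b₁ u ^ 2)
        + (m ^ 2 / u - γ) * (a u ^ 2 + b u ^ 2) - (a u * f₁ u + b u * f₂ u)) / 2)
        = fun u => (Real.exp (γ * u / 4) * (4 * u * (a₁ u ^ 2 + b₁ u ^ 2) + m ^ 2 / u * (a u ^ 2 + b u ^ 2))
          - Real.exp (γ * u / 4) * (γ * (a u ^ 2 + b u ^ 2) + (a u * f₁ u + b u * f₂ u))) / 2 := by
      funext u; ring
    rw [e]; exact (hID.sub hIR).div_const 2
  have hFTC := modulusFlux_gauss_integral_sub hU ha hb hΦac hΦbc hdera hderb hΦa hΦb hint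
  simp only [haU, hbU] at hFTC
  have hsplit : ∫ u in (0:ℝ)..U, Real.exp (γ * u / 4) * (4 * u * (a₁ u ^ 2 + b₁ u ^ 2)
      + (m ^ 2 / u - γ) * (a u ^ 2 + b u ^ 2) - (a u * f₁ u + b u * f₂ u)) / 2
      = ((∫ u in (0:ℝ)..U, Real.exp (γ * u / 4) * (4 * u * (a₁ u ^ 2 + b₁ u ^ 2) + m ^ 2 / u * (a u ^ 2 + b u ^ 2)))
        - ∫ u in (0:ℝ)..U, Real.exp (γ * u / 4) * (γ * (a u ^ 2 + b u ^ 2) + (a u * f₁ u + b u * f₂ u))) / 2 := by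
    rw [← integral_sub hID hIR, ← intervalIntegral.integral_div]
    congr 1; funext u; ring
  rw [hsplit] at hFTC
  norm_num at hFTC
  linarith

end Summit.NavierStokesRegularity.NavierStokesRegularity.Theorems.DefectColumnGate

end
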